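import Summits.BirchSwinnertonDyer.BirchSwinnertonDyer.Theorems.SchneiderFreeAdditiveX3PoitouTateAllPlacesReduction
import Summits.BirchSwinnertonDyer.BirchSwinnertonDyer.Theorems.SchneiderFreeAdditiveX3PoitouTateMiddleExactDualSymmetry
import HarnessLib

/-!
# Poitou–Tate toolkit: the all-places statement `hA` need only be proved for TATE DUALS `M = M₀^D`

Cell `bsd-schneider-ideate`, seat `bsd-schneider-door-c6` (prover, generation 16).  PARTITION: board row
B6 ∩ X3 ∩ sst-twist, `r = 1`, of `Rank1Residual.partition` — CONTROL corner (crux `AnticycControlAdditiveK`,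
stmt-BirchSwinnertonDyer-19295; facts binder `ControlFacts` (i) = `poitouTate_selmerStructure_duality K`).
bears_on: K1-door (r1, B6∩X3-sst) (route-BirchSwinnertonDyer-SchneiderFreeAdditiveX3 item 18969).  Honest framing:
a REDUCTION; nothing here proves BSD or closes a rung.

`poitouTate_selmerStructure_duality_of_allPlaces_canonical` (gen 11) reduces hE to the all-places middle
exactness `hA(n, M)` in `P¹(K, M)` for EVERY finite `n`-torsion `M`.  The presentation road (gen 16,
`middleExact_allPlaces_of_readout`) naturally produces `hA(n, M₀^D)` — the module read off over `K_v` from a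
presentation of `M₀` is `Hom_ℤ(M₀, K̄_vˣ) ≅ M₀^D|_v` (`HomDual.tateDualLocalUnitsIso`).  This file closes the
gap: by biduality `M ≅ M^{DD}` and the dual symmetry of Milne I Thm. 4.10(b)
(`middleExact_canonical_of_middleExact_tateDual`, `isUnramifiedAt_tateDual`), **`hA` for all Tate duals
`M₀^D` (all `n`, all finite `n`-torsion `M₀`) implies `poitouTate_selmerStructure_duality K`**
(`poitouTate_selmerStructure_duality_of_allPlaces_tateDual`).

References: Milne, *Arithmetic Duality Theorems* I Thm. 4.10(b), Prop. 0.19, Cor. 2.3.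
-/

noncomputable section

open Function NumberField IsDedekindDomain
open scoped NumberField

set_option linter.dupNamespace false
set_option autoImplicit false

namespace Summit.BirchSwinnertonDyer.BirchSwinnertonDyer.Theorems.SchneiderFreeAdditiveX3.PoitouTateReduction

open Field
open Literature.NumberTheory.GaloisRepresentations Literature.NumberTheory.GaloisCohomology
open Literature.NumberTheory.GaloisRepresentations.DiscreteGaloisModule (mu TateDual tateDual
  localTatePairingZMod unramifiedSubgroup)

variable {K : Type} [Field K] [NumberField K]

/-- **Milne I Thm. 4.10(b) at every admissible `S`, for `M`, from the ALL-PLACES middle exactness for the Tate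
dual `M^D`** (`middleExact_canonical_of_allPlaces` at `M^D`, admissibility of `S` for `M^D` by
`isUnramifiedAt_tateDual`, then the dual symmetry `middleExact_canonical_of_middleExact_tateDual`).
[cite: MilneADT2006, Ch. I, Thm. 4.10(b), Prop. 0.19 and Cor. 2.3] -/
theorem middleExact_canonical_of_allPlaces_tateDual {n : ℕ} [NeZero n]
    {M : Type} [AddCommGroup M] [TopologicalSpace M] [DiscreteTopology M] [Finite M] [Finite (TateDual K M n)]
    (ρ : DiscreteGaloisModule K M) (hM : ∀ m : M, n • m = 0)
    (hAD : ∀ T : Finset (Place K), (∀ w : InfinitePlace K, (Sum.inl w : Place K) ∈ T) →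
      (∀ v : HeightOneSpectrum (𝓞 K), (Sum.inr v : Place K) ∉ T →
        ((n : ℕ) : 𝓞 K) ∉ v.asIdeal ∧ GaloisRep.IsUnramifiedAt v (ρ.tateDual n)) →
      ∀ u : Π v : Place K, galoisCohomology ((ρ.tateDual n).toLocal v) 1,
        (∀ v : HeightOneSpectrum (𝓞 K), (Sum.inr v : Place K) ∉ T →
          u (Sum.inr v) ∈ unramifiedSubgroup (GaloisRep.toLocal v (ρ.tateDual n)) 1) →
        (∀ (z : galoisCohomology ((ρ.tateDual n).tateDual n) 1) (T' : Finset (Place K)), T ⊆ T' →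
          (∀ v : HeightOneSpectrum (𝓞 K), (Sum.inr v : Place K) ∉ T' →
            galoisCohomology.localization ((ρ.tateDual n).tateDual n) (Sum.inr v) 1 z ∈
              unramifiedSubgroup (GaloisRep.toLocal v ((ρ.tateDual n).tateDual n)) 1) →
          ∑ v ∈ T', localTatePairingZMod (ρ.tateDual n) n v (LocalInvariants.canonical K n v) (u v)
            (galoisCohomology.localization ((ρ.tateDual n).tateDual n) v 1 z) = 0) →
        ∃ y : galoisCohomology (ρ.tateDual n) 1,
          ∀ v : Place K, galoisCohomology.localization (ρ.tateDual n) v 1 y = u v)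
    {S : Finset (Place K)} (hinf : ∀ w : InfinitePlace K, (Sum.inl w : Place K) ∈ S)
    (hS : ∀ v : HeightOneSpectrum (𝓞 K), (Sum.inr v : Place K) ∉ S →
      ((n : ℕ) : 𝓞 K) ∉ v.asIdeal ∧ GaloisRep.IsUnramifiedAt v ρ)
    (t : Π v : Place K, galoisCohomology (ρ.toLocal v) 1)
    (horth : ∀ y : galoisCohomology (ρ.tateDual n) 1,
      (∀ v : HeightOneSpectrum (𝓞 K), (Sum.inr v : Place K) ∉ S →
        galoisCohomology.localization (ρ.tateDual n) (Sum.inr v) 1 y ∈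
          unramifiedSubgroup (GaloisRep.toLocal v (ρ.tateDual n)) 1) →
      ∑ v ∈ S, localTatePairingZMod ρ n v (LocalInvariants.canonical K n v) (t v)
        (galoisCohomology.localization (ρ.tateDual n) v 1 y) = 0) :
    ∃ x : galoisCohomology ρ 1,
      (∀ v : HeightOneSpectrum (𝓞 K), (Sum.inr v : Place K) ∉ S →
        galoisCohomology.localization ρ (Sum.inr v) 1 x ∈ unramifiedSubgroup (GaloisRep.toLocal v ρ) 1) ∧
      ∀ v ∈ S, galoisCohomology.localization ρ v 1 x = t v :=
  middleExact_canonical_of_middleExact_tateDual ρ hM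
    (fun u horthU => middleExact_canonical_of_allPlaces (ρ.tateDual n)
      (fun f => DiscreteGaloisModule.TateDual.nsmul_eq_zero f) hAD hinf
      (fun v hv => ⟨(hS v hv).1, isUnramifiedAt_tateDual ρ v (hS v hv).1 (hS v hv).2⟩) u horthU)
    t horth

/-- **`poitouTate_selmerStructure_duality K` from the all-places middle exactness `hA` for TATE DUALS only.**
If for every `n ≥ 1` and every finite `n`-torsion `M₀` the sequence
`H¹(K, M₀^D) → P¹(K, M₀^D) → H¹(K, M₀^{DD})^*` (THE local invariant maps, all places) is exact in the middle in
the form `hA(n, M₀^D)`, then Milne I Cor. 2.3 ∧ Thm. 4.10(b) ∧ Thm. 2.6 ∧ Howard Thm. 2.1.11 hold for `K`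
(`poitouTate_selmerStructure_duality_of_middleExact_canonical` ∘ `middleExact_canonical_of_allPlaces_tateDual`).
This is the form the presentation road delivers (`middleExact_allPlaces_of_readout` with the readout landing in
`Hom_ℤ(M₀, K̄_vˣ) ≅ M₀^D|_v`). [cite: MilneADT2006, Ch. I, Thm. 4.10(b)]
[cite: Howard2004HeegnerKolyvagin, Thm. 2.1.11 (arXiv:1202.6340 p. 6)] -/
theorem poitouTate_selmerStructure_duality_of_allPlaces_tateDual
    (hAD : ∀ (n : ℕ) [NeZero n],
      ∀ ⦃M : Type⦄ [AddCommGroup M] [TopologicalSpace M] [DiscreteTopology M] [Finite M] [Finite (TateDual K M n)]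
      (ρ : DiscreteGaloisModule K M), (∀ m : M, n • m = 0) →
      ∀ T : Finset (Place K), (∀ w : InfinitePlace K, (Sum.inl w : Place K) ∈ T) →
        (∀ v : HeightOneSpectrum (𝓞 K), (Sum.inr v : Place K) ∉ T →
          ((n : ℕ) : 𝓞 K) ∉ v.asIdeal ∧ GaloisRep.IsUnramifiedAt v (ρ.tateDual n)) →
        ∀ u : Π v : Place K, galoisCohomology ((ρ.tateDual n).toLocal v) 1,
          (∀ v : HeightOneSpectrum (𝓞 K), (Sum.inr v : Place K) ∉ T →
            u (Sum.inr v) ∈ unramifiedSubgroup (GaloisRep.toLocal v (ρ.tateDual n)) 1) →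
          (∀ (z : galoisCohomology ((ρ.tateDual n).tateDual n) 1) (T' : Finset (Place K)), T ⊆ T' →
            (∀ v : HeightOneSpectrum (𝓞 K), (Sum.inr v : Place K) ∉ T' →
              galoisCohomology.localization ((ρ.tateDual n).tateDual n) (Sum.inr v) 1 z ∈
                unramifiedSubgroup (GaloisRep.toLocal v ((ρ.tateDual n).tateDual n)) 1) →
            ∑ v ∈ T', localTatePairingZMod (ρ.tateDual n) n v (LocalInvariants.canonical K n v) (u v)
              (galoisCohomology.localization ((ρ.tateDual n).tateDual n) v 1 z) = 0) →
          ∃ y : galoisCohomology (ρ.tateDual n) 1,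
            ∀ v : Place K, galoisCohomology.localization (ρ.tateDual n) v 1 y = u v) :
    poitouTate_selmerStructure_duality K :=
  poitouTate_selmerStructure_duality_of_middleExact_canonical fun n _ M _ _ _ _ ρ hM _ hinf hS t horth => by
    haveI := DiscreteGaloisModule.TateDual.finite K M n
    exact middleExact_canonical_of_allPlaces_tateDual ρ hM (hAD n ρ hM) hinf hS t horth

end Summit.BirchSwinnertonDyer.BirchSwinnertonDyer.Theorems.SchneiderFreeAdditiveX3.PoitouTateReduction

end
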